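import Literature.NumberTheory.IwasawaTheory.ClassGroupPRankSmallRankCriterion
import Summits.BirchSwinnertonDyer.BirchSwinnertonDyer.Theorems.ByReductionTypeAtTwoAdditivePotGoodLowerHalfT0RankFormRows
import Summits.BirchSwinnertonDyer.BirchSwinnertonDyer.Theorems.ByReductionTypeAtTwoAdditivePotGoodLowerHalfT0TowerCertRowsD
import HarnessLib

/-!
# K4 crux `AdditiveRankZeroAtTwo` (19098), child C3″ `AdditivePotGoodLowerHalfAtTwo` (item 22617): μ-INTERFACES for the rank-form rows `200160bb1`, `306936ce1` and the
# `n₀ = 1` row `306680s1`, and `306680s1` re-keyed on ONE class group (seat `bsd-2adic-k4-w2` GEN 11; `--supports stmt-BirchSwinnertonDyer-22617 --as helper`)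

Cell `bsd-2adic`. Companion of GEN 11's `…LowerHalfT0SmallRankRows{A,B,C,D}` (μ-interfaces of the eight open-type rows). Per row, the μ-INTERFACE
`AddKatoTwo.conjA_two_<L>_of_classicalMu hθ hμ` states: (A) at `2` (`∃ γ D` form, every cyclotomic `κ` over `ℚ`) for the cast cubic model ⟸ `μ₂ = 0` along every
cyclotomic `ℤ₂`-extension of the cubic point field `ℚ(θ)` (`θ` the census generator; the exact change `θ ↔ β = x(P)` to a root of the `2`-division cubic is done once
here), through cruxlead-19573-w2's `ℓ = 2` ascent to the totally complex `ℚ(E[2])` and the guarded kernel Lim 3.5@2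
(`TotallyComplexMu.conjA_two_cubicModel_of_classicalMu_of_discr_neg`, p728213) — so that any future source of `μ₂(ℚ(θ)_cyc) = 0` plugs in by name. For `306680s1`
(GEN 10 `conjA_two_306680s1_of_towerCert`: displayed `TotallyRamifiedFrom κL 1 ∧ rank₂ Cl(layer 2) = rank₂ Cl(layer 1)`) the tree's small-rank criterion at `j = 1`
from layer `n₀ = 1` (`classicalMuVanishes_of_classGroupPRank_succ_le`: `rank₂ Cl(K_{n₀+1}) ≤ p − 2 = 0 ⟹ μ₂ = 0`; Washington §13.3 Prop. 13.23 at finite level) re-keys the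
stamp on `TotallyRamifiedFrom κL 1 ∧ rank₂ Cl(layer 2) = 0` (§1 `conjA_two_306680s1_of_rankZero₂`) — the degree-`6` class group is gone, ONE degree-`12` class group and
the structural `n₀ = 1` remain (the index-`2` prime of `ℚ(θ)` has completion `ℚ₂(√2)` and SPLITS in layer `1`, so none of the layer-`0` dischargers of
`…RankFormRows{B..E}` applies; a kernel `n₀ = 1` would need the first-layer criterion over the SEXTIC field `ℚ(θ, √2)`); §2 re-keys GEN 3's rungs for `306680s1`.

HONEST FRAMING (D-0036 / D-0054 / D-0152): conditional theorems; `hcert` is INSTRUMENT-tier (kit j300990: `cyc12 = []`, PARI/GRH) plus a structural conjunct;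
`hSharp` is the Kato-at-`2` SHARP reading (D-audit PASS). Closes nothing at the `∀`-level (C3″ 22617 / C1″ 22615 OPEN); nothing booked (D-0054); no rung moves;
BSD is not proved by any of this. THEOREMS ONLY (no `def`).

References: [Washington1997] §13.3 Prop. 13.22, 13.23; [Fukuda1994] Thm. 1 (2), p. 264; [Iwasawa1973MuInvariants] Thm. 2/3; [CoatesSujatha2005] (A), Thm. 3.4;
[Kato2004Asterisque] Thm. 12.5 (1)(3), 13.8, 14.14; [Cassels1965ArithmeticVIII] Thm. 1.3; [Miller2011LMS] Def. 1.1.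
-/

set_option autoImplicit false
-- the Theorems namespace of this sub repeats the summit name by design (D-0017 nested layout)
set_option linter.dupNamespace false

noncomputable section

open scoped Classical IntermediateField NumberField Real nonZeroDivisors

/-! ## §1 μ-interfaces (namespace `AddKatoTwo`) -/

namespace Summit.BirchSwinnertonDyer.BirchSwinnertonDyer.Theorems.AddKatoTwo

open WeierstrassCurve Field Polynomial IsDedekindDomain NumberField Matrix Literature.NumberTheory.EllipticCurves
  Literature.NumberTheory.GaloisRepresentations
  Literature.NumberTheory.IwasawaTheory
  Summit.BirchSwinnertonDyer.BirchSwinnertonDyer.Theorems.SteinbergFibreAtTwo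
  Summit.BirchSwinnertonDyer.BirchSwinnertonDyer.Theorems.AlignedTransportAtTwoTorsionPointField
  Summit.BirchSwinnertonDyer.BirchSwinnertonDyer.Theses.ByReductionTypeAtTwo

/-- **A monic integer cubic with a root `β` of degree `3` is irreducible** (restated, file-private). [folklore] -/
private theorem irreducibleCubic_of_finrank_three_srM {p q r : ℤ} {β : AlgebraicClosure ℚ}
    (hβ : aeval β (Cubic.toPoly ⟨1, (p : ℚ), q, r⟩) = 0) (h3 : Module.finrank ℚ (IntermediateField.adjoin ℚ {β}) = 3) :
    Irreducible (Cubic.toPoly ⟨1, (p : ℚ), q, r⟩) := by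
  have hfm : (Cubic.toPoly ⟨1, (p : ℚ), q, r⟩).Monic := Cubic.monic_of_a_eq_one'
  have hβint : IsIntegral ℚ β := ⟨_, hfm, by rwa [← aeval_def]⟩
  have hdeg : (minpoly ℚ β).natDegree = (Cubic.toPoly ⟨1, (p : ℚ), q, r⟩).natDegree := by
    rw [← IntermediateField.adjoin.finrank hβint, h3, Cubic.natDegree_of_a_ne_zero' one_ne_zero]
  have heq : Cubic.toPoly ⟨1, (p : ℚ), q, r⟩ = minpoly ℚ β :=
    Polynomial.eq_of_monic_of_dvd_of_natDegree_le (minpoly.monic hβint) hfm (minpoly.dvd ℚ β hβ) hdeg.ge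
  rw [heq]
  exact minpoly.irreducible hβint

/-- **THE μ-INTERFACE of `200160bb1`, KERNEL** (rank-form row of GEN 10 (`conjA_two_200160bb1_of_rankEq hθ h01`, layers 0/1); `d = −16680`, `2 = 𝔭²𝔮`, `Cl = [2]`): (A) at `2` (`∃ γ D` form, every cyclotomic `κ` over `ℚ`) for the cast cubic model of `200160bb1` from
`μ₂ = 0` along every cyclotomic `ℤ₂`-extension of the CUBIC point field `ℚ(θ)` (`θ` any root of `X³ + (-2)X² + (-29)X + (-120)`; `ℚ(P) = ℚ(β) = ℚ(θ)` with
`β = x(P) = 361562 + (-84876)θ + (-14757)θ²` a root of the `2`-division cubic — exact change of generator) through cruxlead-19573-w2's `ℓ = 2` ascent to the totally complex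
`ℚ(E[2])` (`Δ_cubic < 0`) and the guarded kernel Lim 3.5@2 (`TotallyComplexMu.conjA_two_cubicModel_of_classicalMu_of_discr_neg`, p728213). Any source of
`μ₂(ℚ(θ)_cyc) = 0` (Fukuda two-layer, one-layer small rank, capitulation, …) plugs in by name. No print fact. BSD for `200160bb1` is NOT proved by this.
[cite: CoatesSujatha2005, Conj. A and Thm. 3.4] [cite: Iwasawa1973MuInvariants, Thm. 2 and Thm. 3] -/
theorem conjA_two_200160bb1_of_classicalMu
    {θ : AlgebraicClosure ℚ} (hθ : aeval θ (Cubic.toPoly ⟨1, ((-2 : ℤ) : ℚ), ((-29 : ℤ) : ℚ), ((-120 : ℤ) : ℚ)⟩) = 0)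
    (hμ : haveI : FiniteDimensional ℚ (IntermediateField.adjoin ℚ {θ}) :=
        IntermediateField.adjoin.finiteDimensional ((AlgebraicClosure.isAlgebraic ℚ).isAlgebraic θ).isIntegral
      haveI : NumberField (IntermediateField.adjoin ℚ {θ}) := NumberField.mk
      ∀ κL : ZpExtension (IntermediateField.adjoin ℚ {θ}) 2, κL.IsCyclotomic → ClassicalMuVanishes κL)
    (κ : ZpExtension ℚ 2) (hκ : κ.IsCyclotomic) :
    haveI := (isElliptic_cubicModel _ _ _ (by simp only [Cubic.discr]; norm_num) : (⟨0, ((0 : ℤ) : ℚ), 0, ((-1046032063923 : ℤ) : ℚ), ((411780464906411878 : ℤ) : ℚ)⟩ : WeierstrassCurve ℚ).IsElliptic)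
    ∃ (γ : absoluteGaloisGroup ℚ) (D : (⟨0, ((0 : ℤ) : ℚ), 0, ((-1046032063923 : ℤ) : ℚ), ((411780464906411878 : ℤ) : ℚ)⟩ : WeierstrassCurve ℚ).FineSelmerDualData κ γ),
      Module.Finite ℤ_[2] (RestrictScalars ℤ_[2] (IwasawaAlgebra 2) D.X) := by
  haveI := (isElliptic_cubicModel _ _ _ (by simp only [Cubic.discr]; norm_num) : (⟨0, ((0 : ℤ) : ℚ), 0, ((-1046032063923 : ℤ) : ℚ), ((411780464906411878 : ℤ) : ℚ)⟩ : WeierstrassCurve ℚ).IsElliptic)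
  have hθ' : θ ^ 3 + (-2 : AlgebraicClosure ℚ) * θ ^ 2 + (-29 : AlgebraicClosure ℚ) * θ + (-120 : AlgebraicClosure ℚ) = 0 := by
    have := hθ
    simp only [Cubic.toPoly, map_one, one_mul, aeval_add, aeval_mul, aeval_C, aeval_X_pow, aeval_X,
      eq_ratCast, Rat.cast_intCast] at this
    push_cast at this
    linear_combination this
  set β : AlgebraicClosure ℚ := algebraMap ℚ (AlgebraicClosure ℚ) (361562 : ℚ) +
      algebraMap ℚ (AlgebraicClosure ℚ) (-84876 : ℚ) * θ + algebraMap ℚ (AlgebraicClosure ℚ) (-14757 : ℚ) * θ ^ 2 with hβdef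
  have hβ : aeval β (Cubic.toPoly ⟨1, ((0 : ℤ) : ℚ), ((-1046032063923 : ℤ) : ℚ), ((411780464906411878 : ℤ) : ℚ)⟩) = 0 := by
    simp only [Cubic.toPoly, map_one, one_mul, aeval_add, aeval_mul, aeval_C, aeval_X_pow, aeval_X, eq_ratCast,
      Rat.cast_intCast]
    rw [hβdef]
    simp only [eq_ratCast]
    push_cast
    linear_combination ((-673674702107004 : AlgebraicClosure ℚ) + (-299663968415895 : AlgebraicClosure ℚ) * θ + (-61877333120958 : AlgebraicClosure ℚ) * θ ^ 2 + (-3213617856093 : AlgebraicClosure ℚ) * θ ^ 3) * hθ'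
  have hadj : IntermediateField.adjoin ℚ {β} = IntermediateField.adjoin ℚ {θ} := by
    apply le_antisymm
    · rw [IntermediateField.adjoin_simple_le_iff, hβdef]
      have hθmem := IntermediateField.mem_adjoin_simple_self ℚ θ
      exact add_mem (add_mem (algebraMap_mem _ _) (mul_mem (algebraMap_mem _ _) hθmem))
        (mul_mem (algebraMap_mem _ _) (pow_mem hθmem 2))
    · rw [IntermediateField.adjoin_simple_le_iff]
      have hθeq : θ = algebraMap ℚ (AlgebraicClosure ℚ) (1715429128911329 / 427832148375 : ℚ) +
          algebraMap ℚ (AlgebraicClosure ℚ) (-2909744551 / 855664296750 : ℚ) * β +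
          algebraMap ℚ (AlgebraicClosure ℚ) (-4919 / 855664296750 : ℚ) * β ^ 2 := by
        rw [hβdef]; simp only [eq_ratCast]; push_cast
        linear_combination (((803591987371 : AlgebraicClosure ℚ) / 47536905375) + ((119022883559 : AlgebraicClosure ℚ) / 95073810750) * θ) * hθ'
      rw [hθeq]
      have hβmem := IntermediateField.mem_adjoin_simple_self ℚ β
      exact add_mem (add_mem (algebraMap_mem _ _) (mul_mem (algebraMap_mem _ _) hβmem))
        (mul_mem (algebraMap_mem _ _) (pow_mem hβmem 2))
  haveI : FiniteDimensional ℚ (IntermediateField.adjoin ℚ {θ}) :=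
    IntermediateField.adjoin.finiteDimensional ((AlgebraicClosure.isAlgebraic ℚ).isAlgebraic θ).isIntegral
  haveI : NumberField (IntermediateField.adjoin ℚ {θ}) := NumberField.mk
  have h3 := finrank_adjoin_eq_three_of_irreducible irreducible_cubic_d16680n hθ
  have h3β : Module.finrank ℚ (IntermediateField.adjoin ℚ {β}) = 3 := by rw [hadj]; exact h3
  exact TotallyComplexMu.conjA_two_cubicModel_of_classicalMu_of_discr_neg (0) (-1046032063923) (411780464906411878)
    (irreducibleCubic_of_finrank_three_srM hβ h3β) (by simp only [Cubic.discr]; norm_num) hβ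
    (by rw [hadj]; exact hμ) κ hκ

/-- **THE μ-INTERFACE of `306936ce1`, KERNEL** (rank-form row of GEN 10 (`conjA_two_306936ce1_of_rankEq hθ h01`, layers 0/1); `d = −38367`, `2` splits completely, `Cl = [6]`): (A) at `2` (`∃ γ D` form, every cyclotomic `κ` over `ℚ`) for the cast cubic model of `306936ce1` from
`μ₂ = 0` along every cyclotomic `ℤ₂`-extension of the CUBIC point field `ℚ(θ)` (`θ` any root of `X³ + (0)X² + (-21)X + (-84)`; `ℚ(P) = ℚ(β) = ℚ(θ)` with
`β = x(P) = -903 + (765/2)θ + (129/2)θ²` a root of the `2`-division cubic — exact change of generator) through cruxlead-19573-w2's `ℓ = 2` ascent to the totally complex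
`ℚ(E[2])` (`Δ_cubic < 0`) and the guarded kernel Lim 3.5@2 (`TotallyComplexMu.conjA_two_cubicModel_of_classicalMu_of_discr_neg`, p728213). Any source of
`μ₂(ℚ(θ)_cyc) = 0` (Fukuda two-layer, one-layer small rank, capitulation, …) plugs in by name. No print fact. BSD for `306936ce1` is NOT proved by this.
[cite: CoatesSujatha2005, Conj. A and Thm. 3.4] [cite: Iwasawa1973MuInvariants, Thm. 2 and Thm. 3] -/
theorem conjA_two_306936ce1_of_classicalMu
    {θ : AlgebraicClosure ℚ} (hθ : aeval θ (Cubic.toPoly ⟨1, ((0 : ℤ) : ℚ), ((-21 : ℤ) : ℚ), ((-84 : ℤ) : ℚ)⟩) = 0)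
    (hμ : haveI : FiniteDimensional ℚ (IntermediateField.adjoin ℚ {θ}) :=
        IntermediateField.adjoin.finiteDimensional ((AlgebraicClosure.isAlgebraic ℚ).isAlgebraic θ).isIntegral
      haveI : NumberField (IntermediateField.adjoin ℚ {θ}) := NumberField.mk
      ∀ κL : ZpExtension (IntermediateField.adjoin ℚ {θ}) 2, κL.IsCyclotomic → ClassicalMuVanishes κL)
    (κ : ZpExtension ℚ 2) (hκ : κ.IsCyclotomic) :
    haveI := (isElliptic_cubicModel _ _ _ (by simp only [Cubic.discr]; norm_num) : (⟨0, ((0 : ℤ) : ℚ), 0, ((-9901143 : ℤ) : ℚ), ((-11991571830 : ℤ) : ℚ)⟩ : WeierstrassCurve ℚ).IsElliptic)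
    ∃ (γ : absoluteGaloisGroup ℚ) (D : (⟨0, ((0 : ℤ) : ℚ), 0, ((-9901143 : ℤ) : ℚ), ((-11991571830 : ℤ) : ℚ)⟩ : WeierstrassCurve ℚ).FineSelmerDualData κ γ),
      Module.Finite ℤ_[2] (RestrictScalars ℤ_[2] (IwasawaAlgebra 2) D.X) := by
  haveI := (isElliptic_cubicModel _ _ _ (by simp only [Cubic.discr]; norm_num) : (⟨0, ((0 : ℤ) : ℚ), 0, ((-9901143 : ℤ) : ℚ), ((-11991571830 : ℤ) : ℚ)⟩ : WeierstrassCurve ℚ).IsElliptic)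
  have hθ' : θ ^ 3 + (0 : AlgebraicClosure ℚ) * θ ^ 2 + (-21 : AlgebraicClosure ℚ) * θ + (-84 : AlgebraicClosure ℚ) = 0 := by
    have := hθ
    simp only [Cubic.toPoly, map_one, one_mul, aeval_add, aeval_mul, aeval_C, aeval_X_pow, aeval_X,
      eq_ratCast, Rat.cast_intCast] at this
    push_cast at this
    linear_combination this
  set β : AlgebraicClosure ℚ := algebraMap ℚ (AlgebraicClosure ℚ) (-903 : ℚ) +
      algebraMap ℚ (AlgebraicClosure ℚ) (765 / 2 : ℚ) * θ + algebraMap ℚ (AlgebraicClosure ℚ) (129 / 2 : ℚ) * θ ^ 2 with hβdef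
  have hβ : aeval β (Cubic.toPoly ⟨1, ((0 : ℤ) : ℚ), ((-9901143 : ℤ) : ℚ), ((-11991571830 : ℤ) : ℚ)⟩) = 0 := by
    simp only [Cubic.toPoly, map_one, one_mul, aeval_add, aeval_mul, aeval_C, aeval_X_pow, aeval_X, eq_ratCast,
      Rat.cast_intCast]
    rw [hβdef]
    simp only [eq_ratCast]
    push_cast
    linear_combination ((45085167 : AlgebraicClosure ℚ) + ((90700803 : AlgebraicClosure ℚ) / 4) * θ + ((38191095 : AlgebraicClosure ℚ) / 8) * θ ^ 2 + ((2146689 : AlgebraicClosure ℚ) / 8) * θ ^ 3) * hθ'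
  have hadj : IntermediateField.adjoin ℚ {β} = IntermediateField.adjoin ℚ {θ} := by
    apply le_antisymm
    · rw [IntermediateField.adjoin_simple_le_iff, hβdef]
      have hθmem := IntermediateField.mem_adjoin_simple_self ℚ θ
      exact add_mem (add_mem (algebraMap_mem _ _) (mul_mem (algebraMap_mem _ _) hθmem))
        (mul_mem (algebraMap_mem _ _) (pow_mem hθmem 2))
    · rw [IntermediateField.adjoin_simple_le_iff]
      have hθeq : θ = algebraMap ℚ (AlgebraicClosure ℚ) (15768487 / 174 : ℚ) +
          algebraMap ℚ (AlgebraicClosure ℚ) (26041 / 1044 : ℚ) * β +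
          algebraMap ℚ (AlgebraicClosure ℚ) (-43 / 3132 : ℚ) * β ^ 2 := by
        rw [hβdef]; simp only [eq_ratCast]; push_cast
        linear_combination (((157165 : AlgebraicClosure ℚ) / 232) + ((79507 : AlgebraicClosure ℚ) / 1392) * θ) * hθ'
      rw [hθeq]
      have hβmem := IntermediateField.mem_adjoin_simple_self ℚ β
      exact add_mem (add_mem (algebraMap_mem _ _) (mul_mem (algebraMap_mem _ _) hβmem))
        (mul_mem (algebraMap_mem _ _) (pow_mem hβmem 2))
  haveI : FiniteDimensional ℚ (IntermediateField.adjoin ℚ {θ}) :=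
    IntermediateField.adjoin.finiteDimensional ((AlgebraicClosure.isAlgebraic ℚ).isAlgebraic θ).isIntegral
  haveI : NumberField (IntermediateField.adjoin ℚ {θ}) := NumberField.mk
  have h3 := finrank_adjoin_eq_three_of_irreducible irreducible_cubic_d38367n hθ
  have h3β : Module.finrank ℚ (IntermediateField.adjoin ℚ {β}) = 3 := by rw [hadj]; exact h3
  exact TotallyComplexMu.conjA_two_cubicModel_of_classicalMu_of_discr_neg (0) (-9901143) (-11991571830)
    (irreducibleCubic_of_finrank_three_srM hβ h3β) (by simp only [Cubic.discr]; norm_num) hβ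
    (by rw [hadj]; exact hμ) κ hκ

/-- **THE μ-INTERFACE of `306680s1`, KERNEL** (the `n₀ = 1` row (`d = −18040`, `2 = 𝔭²𝔮` with `𝔭` SPLIT in layer 1: `K_𝔭 = ℚ₂(√2)`; `h = 1`; cubic tower class groups `[], [], []` at layers 0/1/2)): (A) at `2` (`∃ γ D` form, every cyclotomic `κ` over `ℚ`) for the cast cubic model of `306680s1` from
`μ₂ = 0` along every cyclotomic `ℤ₂`-extension of the CUBIC point field `ℚ(θ)` (`θ` any root of `X³ + (-1)X² + (-176)X + (-844)`; `ℚ(P) = ℚ(β) = ℚ(θ)` with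
`β = x(P) = -170721 + (20434)θ + (1393)θ²` a root of the `2`-division cubic — exact change of generator) through cruxlead-19573-w2's `ℓ = 2` ascent to the totally complex
`ℚ(E[2])` (`Δ_cubic < 0`) and the guarded kernel Lim 3.5@2 (`TotallyComplexMu.conjA_two_cubicModel_of_classicalMu_of_discr_neg`, p728213). Any source of
`μ₂(ℚ(θ)_cyc) = 0` (Fukuda two-layer, one-layer small rank, capitulation, …) plugs in by name. No print fact. BSD for `306680s1` is NOT proved by this.
[cite: CoatesSujatha2005, Conj. A and Thm. 3.4] [cite: Iwasawa1973MuInvariants, Thm. 2 and Thm. 3] -/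
theorem conjA_two_306680s1_of_classicalMu
    {θ : AlgebraicClosure ℚ} (hθ : aeval θ (Cubic.toPoly ⟨1, ((-1 : ℤ) : ℚ), ((-176 : ℤ) : ℚ), ((-844 : ℤ) : ℚ)⟩) = 0)
    (hμ : haveI : FiniteDimensional ℚ (IntermediateField.adjoin ℚ {θ}) :=
        IntermediateField.adjoin.finiteDimensional ((AlgebraicClosure.isAlgebraic ℚ).isAlgebraic θ).isIntegral
      haveI : NumberField (IntermediateField.adjoin ℚ {θ}) := NumberField.mk
      ∀ κL : ZpExtension (IntermediateField.adjoin ℚ {θ}) 2, κL.IsCyclotomic → ClassicalMuVanishes κL)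
    (κ : ZpExtension ℚ 2) (hκ : κ.IsCyclotomic) :
    haveI := (isElliptic_cubicModel _ _ _ (by simp only [Cubic.discr]; norm_num) : (⟨0, ((0 : ℤ) : ℚ), 0, ((-181175653763 : ℤ) : ℚ), ((-29682321807131938 : ℤ) : ℚ)⟩ : WeierstrassCurve ℚ).IsElliptic)
    ∃ (γ : absoluteGaloisGroup ℚ) (D : (⟨0, ((0 : ℤ) : ℚ), 0, ((-181175653763 : ℤ) : ℚ), ((-29682321807131938 : ℤ) : ℚ)⟩ : WeierstrassCurve ℚ).FineSelmerDualData κ γ),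
      Module.Finite ℤ_[2] (RestrictScalars ℤ_[2] (IwasawaAlgebra 2) D.X) := by
  haveI := (isElliptic_cubicModel _ _ _ (by simp only [Cubic.discr]; norm_num) : (⟨0, ((0 : ℤ) : ℚ), 0, ((-181175653763 : ℤ) : ℚ), ((-29682321807131938 : ℤ) : ℚ)⟩ : WeierstrassCurve ℚ).IsElliptic)
  have hθ' : θ ^ 3 + (-1 : AlgebraicClosure ℚ) * θ ^ 2 + (-176 : AlgebraicClosure ℚ) * θ + (-844 : AlgebraicClosure ℚ) = 0 := by
    have := hθ
    simp only [Cubic.toPoly, map_one, one_mul, aeval_add, aeval_mul, aeval_C, aeval_X_pow, aeval_X,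
      eq_ratCast, Rat.cast_intCast] at this
    push_cast at this
    linear_combination this
  set β : AlgebraicClosure ℚ := algebraMap ℚ (AlgebraicClosure ℚ) (-170721 : ℚ) +
      algebraMap ℚ (AlgebraicClosure ℚ) (20434 : ℚ) * θ + algebraMap ℚ (AlgebraicClosure ℚ) (1393 : ℚ) * θ ^ 2 with hβdef
  have hβ : aeval β (Cubic.toPoly ⟨1, ((0 : ℤ) : ℚ), ((-181175653763 : ℤ) : ℚ), ((-29682321807131938 : ℤ) : ℚ)⟩) = 0 := by
    simp only [Cubic.toPoly, map_one, one_mul, aeval_add, aeval_mul, aeval_C, aeval_X_pow, aeval_X, eq_ratCast,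
      Rat.cast_intCast]
    rw [hβdef]
    simp only [eq_ratCast]
    push_cast
    linear_combination ((4416598595704 : AlgebraicClosure ℚ) + (1348500849024 : AlgebraicClosure ℚ) * θ + (121656450055 : AlgebraicClosure ℚ) * θ ^ 2 + (2703045457 : AlgebraicClosure ℚ) * θ ^ 3) * hθ'
  have hadj : IntermediateField.adjoin ℚ {β} = IntermediateField.adjoin ℚ {θ} := by
    apply le_antisymm
    · rw [IntermediateField.adjoin_simple_le_iff, hβdef]
      have hθmem := IntermediateField.mem_adjoin_simple_self ℚ θ
      exact add_mem (add_mem (algebraMap_mem _ _) (mul_mem (algebraMap_mem _ _) hθmem))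
        (mul_mem (algebraMap_mem _ _) (pow_mem hθmem 2))
    · rw [IntermediateField.adjoin_simple_le_iff]
      have hθeq : θ = algebraMap ℚ (AlgebraicClosure ℚ) (-84125798207058 / 291070685 : ℚ) +
          algebraMap ℚ (AlgebraicClosure ℚ) (-342308247 / 582141370 : ℚ) * β +
          algebraMap ℚ (AlgebraicClosure ℚ) (1393 / 582141370 : ℚ) * β ^ 2 := by
        rw [hβdef]; simp only [eq_ratCast]; push_cast
        linear_combination (((-82005315189 : AlgebraicClosure ℚ) / 582141370) + ((-2703045457 : AlgebraicClosure ℚ) / 582141370) * θ) * hθ'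
      rw [hθeq]
      have hβmem := IntermediateField.mem_adjoin_simple_self ℚ β
      exact add_mem (add_mem (algebraMap_mem _ _) (mul_mem (algebraMap_mem _ _) hβmem))
        (mul_mem (algebraMap_mem _ _) (pow_mem hβmem 2))
  haveI : FiniteDimensional ℚ (IntermediateField.adjoin ℚ {θ}) :=
    IntermediateField.adjoin.finiteDimensional ((AlgebraicClosure.isAlgebraic ℚ).isAlgebraic θ).isIntegral
  haveI : NumberField (IntermediateField.adjoin ℚ {θ}) := NumberField.mk
  have h3 := finrank_adjoin_eq_three_of_irreducible irreducible_cubic_h306680s1 hθ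
  have h3β : Module.finrank ℚ (IntermediateField.adjoin ℚ {β}) = 3 := by rw [hadj]; exact h3
  exact TotallyComplexMu.conjA_two_cubicModel_of_classicalMu_of_discr_neg (0) (-181175653763) (-29682321807131938)
    (irreducibleCubic_of_finrank_three_srM hβ h3β) (by simp only [Cubic.discr]; norm_num) hβ
    (by rw [hadj]; exact hμ) κ hκ

/-- **(A)₂ for `306680s1` WITHOUT any print fact — the `n₀ = 1` row re-keyed on ONE class group**: along every cyclotomic `ℤ₂`-extension of `ℚ(θ)`
(`θ` any root of `X³ + (-1)X² + (-176)X + (-844)`, `ℚ(P) = ℚ(θ)`), total ramification from layer `1` (STRUCTURAL, displayed: the index-`2` prime of `ℚ(θ)`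
splits in layer `1`, so no layer-`0` discharger applies and the tree's first-layer criterion is cubic-only) AND `rank₂ Cl(layer 2) = 0` (= `2 ∤ h(ℚ(θ)·ℚ₂)`, ONE
number field of degree `12`; instrument tier, kit j300990 `cyc12 = []`). KERNEL: the small-rank criterion at `j = 1` from layer `n₀ = 1`
(`classicalMuVanishes_of_classGroupPRank_succ_le`: `rank₂ Cl(K_{n₀+1}) ≤ p − 2 = 0 ⟹ μ₂ = 0`) and the μ-interface. Compared with GEN 10's
`conjA_two_306680s1_of_towerCert` (`TotallyRamifiedFrom κL 1 ∧ rank₂ Cl(layer 2) = rank₂ Cl(layer 1)`) the degree-`6` class group is GONE.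
BSD for `306680s1` is NOT proved by this. [cite: Washington1997, §13.3 Prop. 13.23] [cite: Fukuda1994, Thm. 1 (2), p. 264] [cite: CoatesSujatha2005, Conj. A and Thm. 3.4] -/
theorem conjA_two_306680s1_of_rankZero₂
    {θ : AlgebraicClosure ℚ} (hθ : aeval θ (Cubic.toPoly ⟨1, ((-1 : ℤ) : ℚ), ((-176 : ℤ) : ℚ), ((-844 : ℤ) : ℚ)⟩) = 0)
    (hcert : haveI : FiniteDimensional ℚ (IntermediateField.adjoin ℚ {θ}) :=
        IntermediateField.adjoin.finiteDimensional ((AlgebraicClosure.isAlgebraic ℚ).isAlgebraic θ).isIntegral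
      haveI : NumberField (IntermediateField.adjoin ℚ {θ}) := NumberField.mk
      ∀ κL : ZpExtension (IntermediateField.adjoin ℚ {θ}) 2, κL.IsCyclotomic →
        TotallyRamifiedFrom κL 1 ∧ classGroupPRank κL 2 = 0)
    (κ : ZpExtension ℚ 2) (hκ : κ.IsCyclotomic) :
    haveI := (isElliptic_cubicModel _ _ _ (by simp only [Cubic.discr]; norm_num) : (⟨0, ((0 : ℤ) : ℚ), 0, ((-181175653763 : ℤ) : ℚ), ((-29682321807131938 : ℤ) : ℚ)⟩ : WeierstrassCurve ℚ).IsElliptic)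
    ∃ (γ : absoluteGaloisGroup ℚ) (D : (⟨0, ((0 : ℤ) : ℚ), 0, ((-181175653763 : ℤ) : ℚ), ((-29682321807131938 : ℤ) : ℚ)⟩ : WeierstrassCurve ℚ).FineSelmerDualData κ γ),
      Module.Finite ℤ_[2] (RestrictScalars ℤ_[2] (IwasawaAlgebra 2) D.X) := by
  haveI : FiniteDimensional ℚ (IntermediateField.adjoin ℚ {θ}) :=
    IntermediateField.adjoin.finiteDimensional ((AlgebraicClosure.isAlgebraic ℚ).isAlgebraic θ).isIntegral
  haveI : NumberField (IntermediateField.adjoin ℚ {θ}) := NumberField.mk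
  exact conjA_two_306680s1_of_classicalMu hθ (fun κL hκL => (classicalMuVanishes_of_classGroupPRank_succ_le κL
    (hcert κL hκL).1 (by have h : classGroupPRank κL (1 + 1) = 0 := (hcert κL hκL).2; omega)).2) κ hκ

end Summit.BirchSwinnertonDyer.BirchSwinnertonDyer.Theorems.AddKatoTwo

/-! ## §2 The C3″ rungs (namespace `AddPotGoodInstances`) -/

namespace Summit.BirchSwinnertonDyer.BirchSwinnertonDyer.Theorems.AddPotGoodInstances

open WeierstrassCurve Polynomial Literature.NumberTheory.EllipticCurves
  Literature.NumberTheory.IwasawaTheory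
  Literature.NumberTheory.EllipticCurves.Rank1Residual
  Literature.NumberTheory.EllipticCurves.Rank1Residual.Typed
  Summit.BirchSwinnertonDyer.Rank1Residual
  Summit.BirchSwinnertonDyer.Rank1Residual.Additive
  Summit.BirchSwinnertonDyer.BirchSwinnertonDyer.Theorems

/-- Model transport for (A) at `2` in the `∃ γ D` spelling (the statement only depends on the Weierstrass CURVE).
[cite: CoatesSujatha2005, statement (A)] -/
private theorem conjA_two_of_eq'' {W W' : WeierstrassCurve ℚ} (h : W' = W)
    (H : ∀ (κ : ZpExtension ℚ 2), κ.IsCyclotomic →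
      ∃ (γ : Field.absoluteGaloisGroup ℚ) (D : W'.FineSelmerDualData κ γ), Module.Finite ℤ_[2] (RestrictScalars ℤ_[2] (IwasawaAlgebra 2) D.X)) :
    ∀ (κ : ZpExtension ℚ 2), κ.IsCyclotomic →
      ∃ (γ : Field.absoluteGaloisGroup ℚ) (D : W.FineSelmerDualData κ γ), Module.Finite ℤ_[2] (RestrictScalars ℤ_[2] (IwasawaAlgebra 2) D.X) := by
  subst h; exact H

/-! ## Row `306680s1` (Δ_cubic < 0, n₀ = 1; stamp `AddKatoTwo.conjA_two_306680s1_of_rankZero₂` of §1) -/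

/-- **(A) at `(306680s1, 2)` for the Cremona model from the displayed pair (n₀ = 1, `rank₂ Cl(layer 2) = 0`), NO print fact**: §1's stamp transported
from its cast model to the literal model. [cite: CoatesSujatha2005, statement (A)] -/
theorem conjA_two_306680s1_of_rankZero₂_kernelLit
    {θ : AlgebraicClosure ℚ} (hθ : aeval θ (Cubic.toPoly ⟨1, ((-1 : ℤ) : ℚ), ((-176 : ℤ) : ℚ), ((-844 : ℤ) : ℚ)⟩) = 0)
    (hcert : haveI : FiniteDimensional ℚ (IntermediateField.adjoin ℚ {θ}) :=
        IntermediateField.adjoin.finiteDimensional ((AlgebraicClosure.isAlgebraic ℚ).isAlgebraic θ).isIntegral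
      haveI : NumberField (IntermediateField.adjoin ℚ {θ}) := NumberField.mk
      ∀ κL : ZpExtension (IntermediateField.adjoin ℚ {θ}) 2, κL.IsCyclotomic →
        TotallyRamifiedFrom κL 1 ∧ classGroupPRank κL 2 = 0)
    :
    haveI := isElliptic_306680s1
    ∀ (κ : ZpExtension ℚ 2), κ.IsCyclotomic →
      ∃ (γ : Field.absoluteGaloisGroup ℚ) (D : (⟨0, 0, 0, -181175653763, -29682321807131938⟩ : WeierstrassCurve ℚ).FineSelmerDualData κ γ),
        Module.Finite ℤ_[2] (RestrictScalars ℤ_[2] (IwasawaAlgebra 2) D.X) :=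
  conjA_two_of_eq'' (W' := (⟨0, ((0 : ℤ) : ℚ), 0, ((-181175653763 : ℤ) : ℚ), ((-29682321807131938 : ℤ) : ℚ)⟩ : WeierstrassCurve ℚ)) (by norm_num) (fun κ hκ ↦ AddKatoTwo.conjA_two_306680s1_of_rankZero₂ hθ hcert κ hκ)

/-- **`BSD₂(306680s1)` with (A) from the displayed pair (n₀ = 1, ONE class group) and NO print fact for (A)**: GEN 3's rung `bsdp_two_306680s1_of_conjA` with `hA` from
`conjA_two_306680s1_of_rankZero₂_kernelLit hθ hcert`; PRINT {`hSharp` (reading), `hGZK`, `hmod`, `hCT`} + RECORD + the two VALUED slots + `hcert`. Nothing booked;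
BSD is not proved by this. [cite: Kato2004Asterisque, Thm. 12.5 (1)(3), 13.8, 14.14] [cite: Washington1997, §13.3 Prop. 13.23] [cite: Miller2011LMS, Def. 1.1] -/
theorem bsdp_two_306680s1_rankZero₂
    (hSharp : Kato2004.rankZero_padicValNat_sha_add_padicValNat_tamagawa_le_at_two_of_irreducible_of_fineSelmerDual_fg)
    (hGZK : rank_eq_analyticRank_of_analyticRank_le_one) (hmod : hasEntireLFunction_rat)
    (hCT : exists_casselsTate_pairing (K := ℚ))
    {θ : AlgebraicClosure ℚ} (hθ : aeval θ (Cubic.toPoly ⟨1, ((-1 : ℤ) : ℚ), ((-176 : ℤ) : ℚ), ((-844 : ℤ) : ℚ)⟩) = 0)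
    (hcert : haveI : FiniteDimensional ℚ (IntermediateField.adjoin ℚ {θ}) :=
        IntermediateField.adjoin.finiteDimensional ((AlgebraicClosure.isAlgebraic ℚ).isAlgebraic θ).isIntegral
      haveI : NumberField (IntermediateField.adjoin ℚ {θ}) := NumberField.mk
      ∀ κL : ZpExtension (IntermediateField.adjoin ℚ {θ}) 2, κL.IsCyclotomic →
        TotallyRamifiedFrom κL 1 ∧ classGroupPRank κL 2 = 0)
    (hr : haveI := isElliptic_306680s1; (⟨0, 0, 0, -181175653763, -29682321807131938⟩ : WeierstrassCurve ℚ).analyticRank = 0)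
    (hs₁ : Nat.card ((⟨0, 0, 0, -181175653763, -29682321807131938⟩ : WeierstrassCurve ℚ).selmerGroup (2 ^ 2)) = 2 ^ 4)
    (hs₂ : Nat.card ((⟨0, 0, 0, -181175653763, -29682321807131938⟩ : WeierstrassCurve ℚ).selmerGroup (2 ^ (2 + 1))) = 2 ^ 6)
    {q : ℚ} (hq : haveI := isElliptic_306680s1; shaAn (⟨0, 0, 0, -181175653763, -29682321807131938⟩ : WeierstrassCurve ℚ) = (q : ℂ)) (hv : padicValRat 2 q ≤ 6) :
    haveI := isElliptic_306680s1; haveI := isGloballyMinimal_306680s1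
    BSDp (⟨0, 0, 0, -181175653763, -29682321807131938⟩ : WeierstrassCurve ℚ) 2 := by
  exact bsdp_two_306680s1_of_conjA hSharp hGZK hmod hCT (conjA_two_306680s1_of_rankZero₂_kernelLit hθ hcert) hr hs₁ hs₂ hq hv

/-- **`BSD₂` ON THE WHOLE CLASS of `306680s1` with (A) from the displayed pair and NO print fact for (A)**: GEN 3's class rung (Cassels transport `hCassels`) with
`hA` from `conjA_two_306680s1_of_rankZero₂_kernelLit hθ hcert`. Nothing booked; BSD is not proved by this. [cite: Cassels1965ArithmeticVIII, Thm. 1.3]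
[cite: Kato2004Asterisque, Thm. 12.5 (1)(3)] -/
theorem bsdp_two_of_isIsogenous_306680s1_rankZero₂
    (hSharp : Kato2004.rankZero_padicValNat_sha_add_padicValNat_tamagawa_le_at_two_of_irreducible_of_fineSelmerDual_fg)
    (hGZK : rank_eq_analyticRank_of_analyticRank_le_one) (hmod : hasEntireLFunction_rat)
    (hCT : exists_casselsTate_pairing (K := ℚ)) (hCassels : bsdRHS_eq_of_isIsogenous)
    {θ : AlgebraicClosure ℚ} (hθ : aeval θ (Cubic.toPoly ⟨1, ((-1 : ℤ) : ℚ), ((-176 : ℤ) : ℚ), ((-844 : ℤ) : ℚ)⟩) = 0)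
    (hcert : haveI : FiniteDimensional ℚ (IntermediateField.adjoin ℚ {θ}) :=
        IntermediateField.adjoin.finiteDimensional ((AlgebraicClosure.isAlgebraic ℚ).isAlgebraic θ).isIntegral
      haveI : NumberField (IntermediateField.adjoin ℚ {θ}) := NumberField.mk
      ∀ κL : ZpExtension (IntermediateField.adjoin ℚ {θ}) 2, κL.IsCyclotomic →
        TotallyRamifiedFrom κL 1 ∧ classGroupPRank κL 2 = 0)
    {W : WeierstrassCurve ℚ} [W.IsElliptic] [W.IsGloballyMinimal]
    (hiso : haveI := isElliptic_306680s1; IsIsogenous W (⟨0, 0, 0, -181175653763, -29682321807131938⟩ : WeierstrassCurve ℚ)) (hr : W.analyticRank = 0)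
    (hs₁ : Nat.card ((⟨0, 0, 0, -181175653763, -29682321807131938⟩ : WeierstrassCurve ℚ).selmerGroup (2 ^ 2)) = 2 ^ 4)
    (hs₂ : Nat.card ((⟨0, 0, 0, -181175653763, -29682321807131938⟩ : WeierstrassCurve ℚ).selmerGroup (2 ^ (2 + 1))) = 2 ^ 6)
    {q : ℚ} (hq : haveI := isElliptic_306680s1; shaAn (⟨0, 0, 0, -181175653763, -29682321807131938⟩ : WeierstrassCurve ℚ) = (q : ℂ)) (hv : padicValRat 2 q ≤ 6) :
    BSDp W 2 := by
  exact bsdp_two_of_isIsogenous_306680s1_of_conjA hSharp hGZK hmod hCT hCassels (conjA_two_306680s1_of_rankZero₂_kernelLit hθ hcert) hiso hr hs₁ hs₂ hq hv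

end Summit.BirchSwinnertonDyer.BirchSwinnertonDyer.Theorems.AddPotGoodInstances

end
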